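import Summits.QuantumFields.BalabanUV.T4Continuum.Support.ShellMeasureSeamStraddlers
import Summits.QuantumFields.BalabanUV.T4Continuum.Support.ShellMeasureSeamDominatedSync

/-!
# `T4Continuum.ShellMeasureSeamStraddlersSync` — SM-L6 (MR)_j FROM THE PER-STRADDLER UNION BOUND, IN THE CURRENCY OF THE
# ENDs OF RECORD: the S38 socket (thresholds BY SLOT, slot-indexed straddler data) and THE HISTORIES-ROAD PLUG (the END-I
# OF RECORD's wall binder for the `s`-small PARTIAL LAW from a supplier law + per-straddler fractions)
# — kernel bookkeeping, no estimate (row S86, file 2 of 2)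
(cell `pub-balaban`, sub-cell `t4`, spine estimate NE7c (node U5b); NE7c ROUND-2 crew, unit
`b2b-balaban-t4-ne7c-formalise-leaf-05` gen 8; row **S86** of `t4/b2b-balaban-t4-ne7c-p1/LEAVES-NE7c-P1.md` (owner g32 RULING
R-ne7cp1-g32-2: audit γ2 delegated); ADDITIVE — imports file 1 `ShellMeasureSeamStraddlers` (§1 `measure_univ_le_of_unionBound_frac`,
`hmass_of_unionBound_frac`, §2 `withDensity_mulIndicator_univ`∕`_le`) and S38 `ShellMeasureSeamDominatedSync` (leaf-01, p217102:
`hac_dominated_slot_sync`, `hac_partialLaw_dominated`) ONLY; [folklore]; 0 `def`, 0 `def … : Prop`, 0 sorry, 0 citation tags)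

HONEST FRAMING.  Finite four-torus programme, rung (B)+1 only — NOT infinite volume, NOT a mass gap, NOT the Clay
problem, NOT summit progress.  NE7c = `T4IndicatorShell.ShellWeightBound` is NOT PRINTED in [Balaban 1983–89] and NOT
PROVED; «NE7c ⇐ the named binders» (trigger c3).  SM-L6 (MR)_j (small-field dominance, B15 p. 193 ∕ B16 (1.89) KIND,
located) is DISPLAYED per straddler (`hfail`) — asserted by nobody, no `def … : Prop` (c2), nothing of Bałaban's
discharged.  HONEST DEPENDENCY (cell): continuum YM on T⁴ ⇐ BetaPertH ∧ nine spine estimates (0/9 proved); BetaPertH ⇐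
(D1) ∧ (D4) ∧ CAP+tail; G-an2-4 gates asym, D1 and NE2/3/4.

THE POINT.  File 1 produces the displayed ratio of the seam socket S22 (thresholds `θ (lvl K s)`) from per-straddler
fractions UNDER THE TERM's MEASURE.  The ENDs OF RECORD (owner rulings T-NE7c-6∕-7) live in the SYNC currency —
thresholds BY SLOT `θ K s`, e.g. by AGE `ε (K − lvl K s)` — where S38 `ShellMeasureSeamDominatedSync` is the socket:
§1 `hac_dominated_slot_sync` (any slot family, slot-indexed ratio `M K t s`) and §2 `hac_partialLaw_dominated` (the
`s`-small PARTIAL LAW of `ShellMeasureRootCompositionHistories`, dominated by a SUPPLIER law `lam K t s` with ONE displayed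
ratio `hmass : lam univ ≤ M·partialLaw univ`).  THIS FILE discharges those `hmass` binders from per-straddler data:
* §1 `hac_straddlers_slot_sync` ∕ `hac_straddlers_level_sync` — the `withDensity` pair of file 1 §2 (term's measure
  `ν.withDensity F′`, actual slot measure `ν.withDensity (F′·1[⋂ Pass])`) in the S38 §1 currency, ratio
  `M K t s := (1 − a K t s)⁻¹` PLACED from `Σ_{i∈I K t s} q K t s i ≤ a K t s < 1`.
* §2 **`hac_partialLaw_straddlers`** — the HISTORIES-ROAD PLUG: FINITE supplier laws `lam K t s`, per-straddler failure
  fractions UNDER `lam`, and the STRUCTURAL socket `hsub : lam (⋂_i Pass i) ≤ partialLaw univ` (the supplier law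
  restricted to «all straddling co-tests pass» sits below the partial law's total mass — e.g. `lam` = the partial law
  with the straddling indicators dropped from every history weight) ⟹ the wall binder `hacA`∕`hacB` of
  `ShellMeasureRootCompositionHistoriesSync.shellWeightBound_histories_sync` (∕ `_age` at `θ K s := ε (K − lvl K s)`)
  TOKEN FOR TOKEN — S38 `hac_partialLaw_dominated` with its `hmass` discharged by file 1 `hmass_of_unionBound_frac`.

* §3 (v1.1) NON-VACUITY + TIGHTNESS (crew rule G-1): on `Ω = Bool`, `μ′ = count`, one straddler failing with relative
  mass `½`, file 1's `measure_univ_le_two_of_unionBound_frac` fires and its ratio `2` is attained (two `example`s).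

WHAT THIS DOES NOT DO.  No fraction, no count, no domination, no (M1) is PROVED for any of Bałaban's measures; END-I's
window ∕ closeness ∕ rate binders untouched; NOTHING in the countdown moves; NE7c NOT proved; spine PROVED 0/9.
-/

noncomputable section

open MeasureTheory Finset
open scoped ENNReal

namespace Summit.QuantumFields.BalabanUV.T4Continuum.ShellMeasureSeamStraddlersSync

open Literature.MathematicalPhysics.QuantumFieldTheory.Balaban1983to89
open T4ShellMeasure (SlotAntiConcentration)
open ShellMeasureRootCompositionHistories (partialLaw)
open ShellMeasureSeamDominatedSync (hac_dominated_slot_sync hac_partialLaw_dominated)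
open ShellMeasureSeamStraddlers (measure_univ_le_of_unionBound_frac hmass_of_unionBound_frac withDensity_mulIndicator_univ
  withDensity_mulIndicator_le)

/-! ## §1 The S38 socket: thresholds BY SLOT, straddler data and ratio slot-indexed -/

section Sync

variable {σ κ : Type*} {Ω : ℕ → σ → Type*} [∀ K s, MeasurableSpace (Ω K s)] {l₀ : ℝ} {S : ℕ → Finset σ}
  {lvl : ℕ → σ → ℕ} {ν : ∀ K : ℕ, ℝ → ∀ s : σ, Measure (Ω K s)} {F' : ∀ K : ℕ, ℝ → ∀ s : σ, Ω K s → ℝ≥0∞}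
  {u : ∀ K : ℕ, ℝ → ∀ s : σ, Ω K s → ℝ} {θ : ℕ → σ → ℝ} {ρ D : ℕ → ℝ} {Dslot a : ℕ → ℝ → σ → ℝ}
  {I : ℕ → ℝ → σ → Finset κ} {Pass : ∀ K : ℕ, ℝ → ∀ s : σ, κ → Set (Ω K s)} {q : ℕ → ℝ → σ → κ → ℝ}

/-- **SM-L6 PER SLOT FROM THE PER-STRADDLER UNION BOUND, THRESHOLDS BY SLOT** — S38
`ShellMeasureSeamDominatedSync.hac_dominated_slot_sync` with `μ′ :=` the term's measure, `μ :=` the actual slot measure,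
`M K t s := (1 − a K t s)⁻¹`, and its `hS`∕`hmass` DISCHARGED from the per-straddler data (`Σ_i q K t s i ≤ a K t s < 1`).
[folklore] -/
theorem hac_straddlers_slot_sync (hρ : ∀ j, 0 ≤ ρ j) (hDslot0 : ∀ K t, |t| ≤ l₀ → ∀ s ∈ S K, 0 ≤ Dslot K t s)
    (hfin : ∀ K t s, ∫⁻ x, F' K t s x ∂(ν K t s) ≠ ∞)
    (hPass : ∀ K t s, ∀ i ∈ I K t s, MeasurableSet (Pass K t s i))
    (hq : ∀ K t s, ∀ i ∈ I K t s, 0 ≤ q K t s i)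
    (hfail : ∀ K t, |t| ≤ l₀ → ∀ s ∈ S K, ∀ i ∈ I K t s,
      (ν K t s).withDensity (F' K t s) (Pass K t s i)ᶜ ≤
        ENNReal.ofReal (q K t s i) * (ν K t s).withDensity (F' K t s) Set.univ)
    (hsum : ∀ K t, |t| ≤ l₀ → ∀ s ∈ S K, ∑ i ∈ I K t s, q K t s i ≤ a K t s)
    (ha1 : ∀ K t, |t| ≤ l₀ → ∀ s ∈ S K, a K t s < 1)
    (hac' : ∀ K t, |t| ≤ l₀ → ∀ s ∈ S K,
      SlotAntiConcentration ((ν K t s).withDensity (F' K t s)) (u K t s) (θ K s) (ρ (lvl K s)) (Dslot K t s)) :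
    ∀ K t, |t| ≤ l₀ → ∀ s ∈ S K,
      SlotAntiConcentration
        ((ν K t s).withDensity fun x => F' K t s x * (⋂ i ∈ I K t s, Pass K t s i).indicator 1 x)
        (u K t s) (θ K s) (ρ (lvl K s)) (Dslot K t s * (1 / (1 - a K t s))) := by
  haveI : ∀ K t s, IsFiniteMeasure ((ν K t s).withDensity (F' K t s)) :=
    fun K t s => isFiniteMeasure_withDensity (hfin K t s)
  refine hac_dominated_slot_sync (μ' := fun K t s => (ν K t s).withDensity (F' K t s))
    (M := fun K t s => 1 / (1 - a K t s)) hρ hDslot0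
    (fun K t _ s _ => withDensity_mulIndicator_le (ν K t s) (F' K t s) _ _) (fun K t ht s hs => ?_) hac'
  rw [withDensity_mulIndicator_univ (ν K t s) (F' K t s) (Finset.measurableSet_biInter _ (hPass K t s))]
  exact measure_univ_le_of_unionBound_frac _ (I K t s) (Pass K t s) (q K t s) (hq K t s) (hfail K t ht s hs)
    (hsum K t ht s hs) (ha1 K t ht s hs)

/-- **… LEVEL-CONSTANT FORM (END-I-sync's `hac` VERBATIM)**: PLUS the displayed majorant
`Dslot K t s · (1 − a K t s)⁻¹ ≤ D (lvl K s)` (S38 `hac_dominated_level_sync`'s road). [folklore] -/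
theorem hac_straddlers_level_sync (hρ : ∀ j, 0 ≤ ρ j) (hDslot0 : ∀ K t, |t| ≤ l₀ → ∀ s ∈ S K, 0 ≤ Dslot K t s)
    (hfin : ∀ K t s, ∫⁻ x, F' K t s x ∂(ν K t s) ≠ ∞)
    (hPass : ∀ K t s, ∀ i ∈ I K t s, MeasurableSet (Pass K t s i))
    (hq : ∀ K t s, ∀ i ∈ I K t s, 0 ≤ q K t s i)
    (hfail : ∀ K t, |t| ≤ l₀ → ∀ s ∈ S K, ∀ i ∈ I K t s,
      (ν K t s).withDensity (F' K t s) (Pass K t s i)ᶜ ≤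
        ENNReal.ofReal (q K t s i) * (ν K t s).withDensity (F' K t s) Set.univ)
    (hsum : ∀ K t, |t| ≤ l₀ → ∀ s ∈ S K, ∑ i ∈ I K t s, q K t s i ≤ a K t s)
    (ha1 : ∀ K t, |t| ≤ l₀ → ∀ s ∈ S K, a K t s < 1)
    (hDM : ∀ K t, |t| ≤ l₀ → ∀ s ∈ S K, Dslot K t s * (1 / (1 - a K t s)) ≤ D (lvl K s))
    (hac' : ∀ K t, |t| ≤ l₀ → ∀ s ∈ S K,
      SlotAntiConcentration ((ν K t s).withDensity (F' K t s)) (u K t s) (θ K s) (ρ (lvl K s)) (Dslot K t s)) :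
    ∀ K t, |t| ≤ l₀ → ∀ s ∈ S K,
      SlotAntiConcentration
        ((ν K t s).withDensity fun x => F' K t s x * (⋂ i ∈ I K t s, Pass K t s i).indicator 1 x)
        (u K t s) (θ K s) (ρ (lvl K s)) (D (lvl K s)) :=
  ShellMeasureRootCompositionSync.hac_of_slotConst_sync
    (μ := fun K t s => (ν K t s).withDensity fun x => F' K t s x * (⋂ i ∈ I K t s, Pass K t s i).indicator 1 x)
    (Dslot := fun K t s => Dslot K t s * (1 / (1 - a K t s))) hρ hDM
    (hac_straddlers_slot_sync hρ hDslot0 hfin hPass hq hfail hsum ha1 hac')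

end Sync

/-! ## §2 The histories road: the END of record's wall binder from a supplier law + per-straddler fractions -/

section Histories

variable {Ω : ℕ → Type*} [∀ K, MeasurableSpace (Ω K)] {σ ι κ : Type*} [DecidableEq σ] {T : ℕ → Finset ι}
  {C : ℕ → Finset σ} {small : ℕ → ι → Finset σ} {lvl : ℕ → σ → ℕ} {l₀ : ℝ} {θ : ℕ → σ → ℝ} {ρ : ℕ → ℝ}

/-- **THE HISTORIES END's WALL BINDER FROM A SUPPLIER LAW + PER-STRADDLER FRACTIONS.**  For ONE run with history
weights `ν K t τ`, tested variables `u K t s`, thresholds `θ K s`: FINITE supplier laws `lam K t s` dominating the `s`-small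
partial law on the threshold shell (`hS`) and carrying (M1) with slot constants `Dslot K t s ≥ 0` (`hlam` — END-II's
business at live levels); per slot finitely many straddlers `i ∈ I K t s` with pass events `Pass K t s i`, DISPLAYED
failure fractions `0 ≤ q K t s i` UNDER `lam` (`hfail`, SM-L6 (MR)_j), `Σ_i q K t s i ≤ a K t s < 1`; the socket
`hsub : lam (⋂_i Pass i) ≤ partialLaw univ`; the majorant `Dslot·(1 − a)⁻¹ ≤ D (lvl K s)` ⟹ the binder `hacA`∕`hacB` of
`ShellMeasureRootCompositionHistoriesSync.shellWeightBound_histories_sync` (∕ `_age` at `θ K s := ε (K − lvl K s)`) TOKEN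
FOR TOKEN — `hac_partialLaw_dominated` with `M K t s := (1 − a K t s)⁻¹` and its `hmass` discharged by file 1.
CONDITIONAL; nothing printed asserted. [folklore] -/
theorem hac_partialLaw_straddlers {ν : ∀ K : ℕ, ℝ → ι → Measure (Ω K)} {u : ∀ K : ℕ, ℝ → σ → Ω K → ℝ}
    {D : ℕ → ℝ} {lam : ∀ K : ℕ, ℝ → σ → Measure (Ω K)} [∀ K t s, IsFiniteMeasure (lam K t s)]
    {Dslot a : ℕ → ℝ → σ → ℝ} {I : ℕ → ℝ → σ → Finset κ} {Pass : ∀ K : ℕ, ℝ → σ → κ → Set (Ω K)}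
    {q : ℕ → ℝ → σ → κ → ℝ}
    (hρ : ∀ j, 0 ≤ ρ j) (hDslot0 : ∀ K t, |t| ≤ l₀ → ∀ s ∈ C K, 0 ≤ Dslot K t s)
    (hS : ∀ K t, |t| ≤ l₀ → ∀ s ∈ C K,
      partialLaw (T K) (ν K t) (small K) (u K t) (θ K) s
          {x | θ K s * (1 - ρ (lvl K s)) ≤ u K t s x ∧ u K t s x < θ K s} ≤
        lam K t s {x | θ K s * (1 - ρ (lvl K s)) ≤ u K t s x ∧ u K t s x < θ K s})
    (hq : ∀ K t s, ∀ i ∈ I K t s, 0 ≤ q K t s i)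
    (hfail : ∀ K t, |t| ≤ l₀ → ∀ s ∈ C K, ∀ i ∈ I K t s,
      lam K t s (Pass K t s i)ᶜ ≤ ENNReal.ofReal (q K t s i) * lam K t s Set.univ)
    (hsum : ∀ K t, |t| ≤ l₀ → ∀ s ∈ C K, ∑ i ∈ I K t s, q K t s i ≤ a K t s)
    (ha1 : ∀ K t, |t| ≤ l₀ → ∀ s ∈ C K, a K t s < 1)
    (hsub : ∀ K t, |t| ≤ l₀ → ∀ s ∈ C K,
      lam K t s (⋂ i ∈ I K t s, Pass K t s i) ≤ partialLaw (T K) (ν K t) (small K) (u K t) (θ K) s Set.univ)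
    (hDM : ∀ K t, |t| ≤ l₀ → ∀ s ∈ C K, Dslot K t s * (1 / (1 - a K t s)) ≤ D (lvl K s))
    (hlam : ∀ K t, |t| ≤ l₀ → ∀ s ∈ C K,
      SlotAntiConcentration (lam K t s) (u K t s) (θ K s) (ρ (lvl K s)) (Dslot K t s)) :
    ∀ K t, |t| ≤ l₀ → ∀ s ∈ C K,
      SlotAntiConcentration (partialLaw (T K) (ν K t) (small K) (u K t) (θ K) s) (u K t s)
        (θ K s) (ρ (lvl K s)) (D (lvl K s)) :=
  hac_partialLaw_dominated (M := fun K t s => 1 / (1 - a K t s)) hρ hDslot0 hS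
    (fun K t ht s hs => hmass_of_unionBound_frac (lam K t s) (I K t s) (Pass K t s) (q K t s) (hq K t s)
      (hfail K t ht s hs) (hsum K t ht s hs) (ha1 K t ht s hs) (hsub K t ht s hs)) hDM hlam

end Histories

/-! ## §3 Non-vacuity and TIGHTNESS of the union bound (crew rule G-1: a joint-inhabitation witness) -/

section Toy

/-- **NON-VACUITY + TIGHTNESS (v1.1).**  `Ω = Bool`, the term's measure `μ′ = count` (mass `2`), ONE straddler whose
co-test passes exactly on `{true}` — it FAILS with relative `μ′`-mass `½`, so `Σ q = ½`: file 1's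
`measure_univ_le_two_of_unionBound_frac` FIRES (all its binders jointly inhabited with a failing straddler present), and
its ratio `2` is ATTAINED — see the next `example`. [folklore] -/
example : (Measure.count : Measure Bool) Set.univ ≤
    ENNReal.ofReal 2 * (Measure.count : Measure Bool) (⋂ i ∈ ({()} : Finset Unit), ({true} : Set Bool)) := by
  have hU : (Measure.count : Measure Bool) Set.univ = 2 := by
    rw [Measure.count_univ]; simp
  haveI : IsFiniteMeasure (Measure.count : Measure Bool) := ⟨by rw [hU]; norm_num⟩
  refine ShellMeasureSeamStraddlers.measure_univ_le_two_of_unionBound_frac (Measure.count : Measure Bool)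
    ({()} : Finset Unit)
    (fun _ => ({true} : Set Bool)) (fun _ => 1 / 2) (fun _ _ => by norm_num) (fun _ _ => ?_) (by simp)
  have hc : ({true} : Set Bool)ᶜ = {false} := by ext b; cases b <;> simp
  rw [hc, Measure.count_singleton, hU]
  rw [show ENNReal.ofReal (1 / 2) * 2 = 1 by
    rw [ENNReal.ofReal_div_of_pos two_pos, ENNReal.ofReal_one, ENNReal.ofReal_ofNat,
      ENNReal.div_mul_cancel two_ne_zero ENNReal.ofNat_ne_top]]

/-- **… BOTH SIDES EQUAL `2`**: `μ′ univ = 2` and `ofReal 2 · μ′(⋂ Pass) = 2·count{true} = 2` — the ratio `(1 − Σq)⁻¹`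
of file 1 §1 cannot be improved in general. [folklore] -/
example : (Measure.count : Measure Bool) Set.univ = 2 ∧
    ENNReal.ofReal 2 * (Measure.count : Measure Bool) (⋂ i ∈ ({()} : Finset Unit), ({true} : Set Bool)) = 2 := by
  refine ⟨by rw [Measure.count_univ]; simp, ?_⟩
  rw [Finset.set_biInter_singleton, Measure.count_singleton, ENNReal.ofReal_ofNat, mul_one]

end Toy

end Summit.QuantumFields.BalabanUV.T4Continuum.ShellMeasureSeamStraddlersSync

end
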